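import Mathlib
import HarnessLib
import Summits.QuantumFields.YangMills.Theorems.PencilRigidityWeakCouplingHypercubicLimitStubCountertermBound
import Summits.QuantumFields.YangMills.Theorems.ContinuumLimitOnTrajectory.Negative.ThreePoint

/-!
# `WeakCouplingHypercubicLimit` — stub `stub_countertermBoundOfSkewFloor` (line `Sketch`, reshape r12)

Crux `stmt-QuantumFields-16120` (`PencilRigidity.WeakCouplingHypercubicLimit`), line `Sketch`
(`trace-norm-cold-pressure`), stub `stub_countertermBoundOfSkewFloor` (P3): **the additive counterterms of
the curvature are bounded**, `∃ Cm, ∀ k, |m_k| ≤ Cm`, given the `k`-uniform plane-resolved moment bounds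
`UniformMomentBoundsPlanes r sch` and the THIRD-CUMULANT floor
`δ ≤ |LS₃(f,g,h) − LS₁(f)LS₂(g,h) − LS₁(g)LS₂(f,h) − LS₁(h)LS₂(f,g) + 2 LS₁(f)LS₁(g)LS₁(h)|` eventually in `k`.

Route (the sister stub `stub_countertermBound` with the `κ₃` floor replacing the two-point floor).
1. `c³`-scaling and `m`-invisibility of the truncated lattice three-point function
   (`ContinuumLimitOnTrajectory.Negative.latticeSchwinger_conn_three_eq`): the floored combination is
   `c_k³ K3_k(f,g,h)`, `K3_k` the third cumulant of the unit-normalised fields `Φ_{1,0}(u)` under the torus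
   Wilson state, a probability measure; `|Φ_{1,0}(u)| ≤ R_k(|u|) B_c` (`R_k(|u|) = a_k⁴ Σₓ |u(a_k x)|`,
   `|tr F²| ≤ B_c`), and third cumulants of bounded variables are bounded (`abs_cum3_le`:
   `|κ₃(X,Y,Z)| ≤ 6 ABC`); with the mesh-uniform Riemann bounds `R_k(|u|) ≤ C_u` (`exists_latticeSum_le`)
   this gives `δ ≤ |c_k|³ D` eventually, hence `D > 0` and `|c_k| ≥ min 1 (δ/D) > 0` eventually.
2.–5. Verbatim the sister file: UMBP at `n = 1` on one plane with the normalised plateau bump,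
   `abs_c_mul_riemann_mul_sub_le`, the plateau count `pow_le_sum_box`, and
   `exists_forall_abs_le_of_eventually`. [folklore]
-/

noncomputable section

open scoped SchwartzMap
open MeasureTheory Filter Topology
open Literature.MathematicalPhysics.AQFT Literature.MathematicalPhysics.QuantumLattice
  Literature.MathematicalPhysics.QuantumFieldTheory
open Literature.Probability.LatticeModels (Site box mem_box)
open Summit.QuantumFields.YangMills.Cruxes.HypercubicLimit.CouplingResponse
open Summit.QuantumFields.YangMills.Theorems.CurvatureKernel (abs_integral_le_of_abs_le)
open Summit.QuantumFields.YangMills.Theorems.OSLegsFromFemtoAndGap.StubLower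
  (pow_le_sum_box exists_bump_schwartz)
open Summit.QuantumFields.YangMills.Theorems.ContinuumLimitOnTrajectory.Negative
  (cum3 unitField threePointKernel latticeSchwinger_conn_three_eq)

namespace Summit.QuantumFields.YangMills.Theorems.WeakCouplingHypercubicLimit.TraceNormColdPressure

/-! ## Third cumulants of bounded random variables -/

/-- Triangle inequality for the five-term shape of a third cumulant. [folklore] -/
theorem abs_sub_sub_sub_add_le (a b c d e : ℝ) :
    |a - b - c - d + e| ≤ |a| + |b| + |c| + |d| + |e| := by
  have h1 := abs_add_le (a - b - c - d) e
  have h2 := abs_sub (a - b - c) d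
  have h3 := abs_sub (a - b) c
  have h4 := abs_sub a b
  linarith

/-- **Third cumulants of bounded variables are bounded.** Under a probability measure, if
`|X| ≤ A`, `|Y| ≤ B`, `|Z| ≤ C` pointwise then `|κ₃(X, Y, Z)| ≤ 6ABC` (each of the five terms of
`κ₃ = E[XYZ] − E[X]E[YZ] − E[Y]E[XZ] − E[Z]E[XY] + 2E[X]E[Y]E[Z]` is a product of expectations of
bounded functions; `1 + 1 + 1 + 1 + 2 = 6`). [folklore] -/
theorem abs_cum3_le {Ω : Type*} [MeasurableSpace Ω] (μ : Measure Ω) [IsProbabilityMeasure μ]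
    {X Y Z : Ω → ℝ} {A B C : ℝ} (hX : ∀ ω, |X ω| ≤ A) (hY : ∀ ω, |Y ω| ≤ B)
    (hZ : ∀ ω, |Z ω| ≤ C) : |cum3 μ X Y Z| ≤ 6 * (A * B * C) := by
  have eX : |∫ ω, X ω ∂μ| ≤ A := abs_integral_le_of_abs_le hX
  have eY : |∫ ω, Y ω ∂μ| ≤ B := abs_integral_le_of_abs_le hY
  have eZ : |∫ ω, Z ω ∂μ| ≤ C := abs_integral_le_of_abs_le hZ
  have hA : 0 ≤ A := (abs_nonneg _).trans eX
  have hB : 0 ≤ B := (abs_nonneg _).trans eY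
  have hXY : ∀ ω, |X ω * Y ω| ≤ A * B := fun ω => by
    rw [abs_mul]; exact mul_le_mul (hX ω) (hY ω) (abs_nonneg _) hA
  have eXY : |∫ ω, X ω * Y ω ∂μ| ≤ A * B := abs_integral_le_of_abs_le hXY
  have eXZ : |∫ ω, X ω * Z ω ∂μ| ≤ A * C := abs_integral_le_of_abs_le fun ω => by
    rw [abs_mul]; exact mul_le_mul (hX ω) (hZ ω) (abs_nonneg _) hA
  have eYZ : |∫ ω, Y ω * Z ω ∂μ| ≤ B * C := abs_integral_le_of_abs_le fun ω => by
    rw [abs_mul]; exact mul_le_mul (hY ω) (hZ ω) (abs_nonneg _) hB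
  have eXYZ : |∫ ω, X ω * Y ω * Z ω ∂μ| ≤ A * B * C := abs_integral_le_of_abs_le fun ω => by
    rw [abs_mul]; exact mul_le_mul (hXY ω) (hZ ω) (abs_nonneg _) (mul_nonneg hA hB)
  have t1 : |(∫ ω, X ω ∂μ) * ∫ ω, Y ω * Z ω ∂μ| ≤ A * B * C := by
    rw [abs_mul, mul_assoc]; exact mul_le_mul eX eYZ (abs_nonneg _) hA
  have t2 : |(∫ ω, Y ω ∂μ) * ∫ ω, X ω * Z ω ∂μ| ≤ A * B * C := by
    rw [abs_mul, show A * B * C = B * (A * C) by ring]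
    exact mul_le_mul eY eXZ (abs_nonneg _) hB
  have t3 : |(∫ ω, Z ω ∂μ) * ∫ ω, X ω * Y ω ∂μ| ≤ A * B * C := by
    rw [abs_mul, show A * B * C = C * (A * B) by ring]
    exact mul_le_mul eZ eXY (abs_nonneg _) ((abs_nonneg _).trans eZ)
  have t4 : |2 * ((∫ ω, X ω ∂μ) * (∫ ω, Y ω ∂μ) * ∫ ω, Z ω ∂μ)| ≤ 2 * (A * B * C) := by
    rw [abs_mul, abs_two, abs_mul, abs_mul]
    exact mul_le_mul_of_nonneg_left
      (mul_le_mul (mul_le_mul eX eY (abs_nonneg _) hA) eZ (abs_nonneg _) (mul_nonneg hA hB))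
      zero_le_two
  unfold cum3
  refine (abs_sub_sub_sub_add_le _ _ _ _ _).trans ?_
  linarith

/-! ## The unit-normalised three-point kernel of the curvature -/

section Lattice

variable {G : Type} [Group G] [TopologicalSpace G] [IsTopologicalGroup G] [CompactSpace G]
  [MeasurableSpace G] [BorelSpace G]

/-- **The unit-normalised connected three-point kernel is bounded by Riemann sums**: with
`|tr F²| ≤ B_c`, `|K3_{a,β,L}(f, g, h)| ≤ 6 (R(|f|)B_c)(R(|g|)B_c)(R(|h|)B_c)`,
`R(|u|) = a⁴ Σ_{x ∈ box} |u(a x)|` (`|Φ_{1,0}(u)| ≤ R(|u|) B_c` and `abs_cum3_le` under the torus Wilson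
state). [folklore] -/
theorem abs_threePointKernel_le (r : LatticeRep G) {Bc : ℝ} (hBc : ∀ U, |r.curvature.F U| ≤ Bc)
    (a β : ℝ) (L : ℕ) (f g h : 𝓢(EuclideanSpace ℝ (Fin 4), ℝ)) :
    |threePointKernel r.ρ a β L f g h| ≤
      6 * ((a ^ 4 * ∑ x ∈ box 4 L, |f (a • siteToE x)|) * Bc *
        ((a ^ 4 * ∑ x ∈ box 4 L, |g (a • siteToE x)|) * Bc) *
        ((a ^ 4 * ∑ x ∈ box 4 L, |h (a • siteToE x)|) * Bc)) := by
  haveI : IsProbabilityMeasure (wilsonMeasure (d := 4) (L := 2 * L + 1) r.ρ β) :=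
    isProbabilityMeasure_wilsonMeasure (d := 4) (L := 2 * L + 1) r.ρ r.continuous β
  have hb : ∀ (u : 𝓢(EuclideanSpace ℝ (Fin 4), ℝ)) (U : GaugeConfig 4 (2 * L + 1) G),
      |unitField r.ρ a L u U| ≤ (a ^ 4 * ∑ x ∈ box 4 L, |u (a • siteToE x)|) * Bc := fun u U => by
    have hu := abs_smearedLatticeField_le hBc (box 4 L) a 1 0 u (torusLift (2 * L + 1) U)
    rw [abs_one, one_mul, abs_zero, add_zero] at hu
    exact hu
  unfold threePointKernel
  exact abs_cum3_le _ (hb f) (hb g) (hb h)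

/-- **`c³`-scaling bound of the truncated lattice three-point function of the curvature**:
`|LS₃(f,g,h) − LS₁(f)LS₂(g,h) − LS₁(g)LS₂(f,h) − LS₁(h)LS₂(f,g) + 2LS₁(f)LS₁(g)LS₁(h)|
≤ |c_k|³ · 6 (R_k(|f|)B_c)(R_k(|g|)B_c)(R_k(|h|)B_c)` (the combination is `c_k³ K3_k(f,g,h)`,
`latticeSchwinger_conn_three_eq`; the counterterm `m_k` does not enter). [folklore] -/
theorem abs_conn_three_le (r : LatticeRep G) (sch : SpeciesScheme (YMSpecies G)) {Bc : ℝ}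
    (hBc : ∀ U, |r.curvature.F U| ≤ Bc) (k : ℕ) (f g h : 𝓢(EuclideanSpace ℝ (Fin 4), ℝ)) :
    |latticeSchwinger r.ρ sch (fun s => s.F) k 3 (fun _ => r.curvature) ![f, g, h] -
        latticeSchwinger r.ρ sch (fun s => s.F) k 1 (fun _ => r.curvature) ![f] *
          latticeSchwinger r.ρ sch (fun s => s.F) k 2 (fun _ => r.curvature) ![g, h] -
        latticeSchwinger r.ρ sch (fun s => s.F) k 1 (fun _ => r.curvature) ![g] *
          latticeSchwinger r.ρ sch (fun s => s.F) k 2 (fun _ => r.curvature) ![f, h] -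
        latticeSchwinger r.ρ sch (fun s => s.F) k 1 (fun _ => r.curvature) ![h] *
          latticeSchwinger r.ρ sch (fun s => s.F) k 2 (fun _ => r.curvature) ![f, g] +
        2 * (latticeSchwinger r.ρ sch (fun s => s.F) k 1 (fun _ => r.curvature) ![f] *
          latticeSchwinger r.ρ sch (fun s => s.F) k 1 (fun _ => r.curvature) ![g] *
          latticeSchwinger r.ρ sch (fun s => s.F) k 1 (fun _ => r.curvature) ![h])| ≤
      |sch.c r.curvature k| ^ 3 *
        (6 * ((sch.a k ^ 4 * ∑ x ∈ box 4 (sch.L k), |f (sch.a k • siteToE x)|) * Bc *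
          ((sch.a k ^ 4 * ∑ x ∈ box 4 (sch.L k), |g (sch.a k • siteToE x)|) * Bc) *
          ((sch.a k ^ 4 * ∑ x ∈ box 4 (sch.L k), |h (sch.a k • siteToE x)|) * Bc))) := by
  -- `latticeSchwinger_conn_three_eq` is stated with arity `1 + 1`; the arity-`2` form is definitionally equal
  have h3 : latticeSchwinger r.ρ sch (fun s => s.F) k 3 (fun _ => r.curvature) ![f, g, h] -
        latticeSchwinger r.ρ sch (fun s => s.F) k 1 (fun _ => r.curvature) ![f] *
          latticeSchwinger r.ρ sch (fun s => s.F) k 2 (fun _ => r.curvature) ![g, h] -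
        latticeSchwinger r.ρ sch (fun s => s.F) k 1 (fun _ => r.curvature) ![g] *
          latticeSchwinger r.ρ sch (fun s => s.F) k 2 (fun _ => r.curvature) ![f, h] -
        latticeSchwinger r.ρ sch (fun s => s.F) k 1 (fun _ => r.curvature) ![h] *
          latticeSchwinger r.ρ sch (fun s => s.F) k 2 (fun _ => r.curvature) ![f, g] +
        2 * (latticeSchwinger r.ρ sch (fun s => s.F) k 1 (fun _ => r.curvature) ![f] *
          latticeSchwinger r.ρ sch (fun s => s.F) k 1 (fun _ => r.curvature) ![g] *
          latticeSchwinger r.ρ sch (fun s => s.F) k 1 (fun _ => r.curvature) ![h]) =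
      sch.c r.curvature k ^ 3 * threePointKernel r.ρ (sch.a k) (sch.β k) (sch.L k) f g h :=
    latticeSchwinger_conn_three_eq r sch k f g h
  rw [h3, abs_mul, abs_pow]
  exact mul_le_mul_of_nonneg_left (abs_threePointKernel_le r hBc _ _ _ f g h) (by positivity)

end Lattice

/-! ## The stub -/

/-- **P3 · `stub_countertermBoundOfSkewFloor` (line `Sketch`, r12).** The `k`-uniform plane-resolved
moment bound at `n = 1` and the third-cumulant floor force bounded additive counterterms of the
curvature: `∃ Cm, ∀ k, |m_k| ≤ Cm` (the `κ₃` floor pins `|c_k| ≥ c₀ > 0` eventually, third cumulants of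
bounded variables being bounded and scaling as `c_k³`; UMBP at `n = 1` on a non-negative plateau bump pins
`|c_k| (|m_k|/6 − B_w) ≤ 16 C₀C₁/t`). [folklore] -/
theorem stub_countertermBoundOfSkewFloor : ∀ (G : Type) [Group G] [TopologicalSpace G] [IsTopologicalGroup G] [CompactSpace G] [MeasurableSpace G] [BorelSpace G] (r : LatticeRep G) (sch : SpeciesScheme (YMSpecies G)), UniformMomentBoundsPlanes r sch → (∃ (f g h : 𝓢(EuclideanSpace ℝ (Fin 4), ℝ)) (δ : ℝ), 0 < δ ∧ ∀ᶠ k in atTop, δ ≤ |latticeSchwinger r.ρ sch (fun s => s.F) k 3 (fun _ => r.curvature) ![f, g, h] - latticeSchwinger r.ρ sch (fun s => s.F) k 1 (fun _ => r.curvature) ![f] * latticeSchwinger r.ρ sch (fun s => s.F) k 2 (fun _ => r.curvature) ![g, h] - latticeSchwinger r.ρ sch (fun s => s.F) k 1 (fun _ => r.curvature) ![g] * latticeSchwinger r.ρ sch (fun s => s.F) k 2 (fun _ => r.curvature) ![f, h] - latticeSchwinger r.ρ sch (fun s => s.F) k 1 (fun _ => r.curvature) ![h] * latticeSchwinger r.ρ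 sch (fun s => s.F) k 2 (fun _ => r.curvature) ![f, g] + 2 * (latticeSchwinger r.ρ sch (fun s => s.F) k 1 (fun _ => r.curvature) ![f] * latticeSchwinger r.ρ sch (fun s => s.F) k 1 (fun _ => r.curvature) ![g] * latticeSchwinger r.ρ sch (fun s => s.F) k 1 (fun _ => r.curvature) ![h])|) → ∃ Cm : ℝ, ∀ k, |sch.m r.curvature k| ≤ Cm := by
  intro G _ _ _ _ _ _ r sch hU hSK
  obtain ⟨s, C₀, C₁, hU⟩ := hU
  obtain ⟨f, g, h, δ, hδ, hSK⟩ := hSK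
  -- adapted from `stub_countertermBound` (PencilRigidityWeakCouplingHypercubicLimitStubCountertermBound.lean)
  -- the normalised plateau bump `p = t • p₀`
  obtain ⟨p₀, hp₀0, -, hp₀1, -, -⟩ := exists_bump_schwartz (0 : EuclideanSpace ℝ (Fin 4)) one_pos
  have hN₀ : 0 ≤ schwartzNorm s (ofRealTest p₀) := schwartzNorm_nonneg _ _
  set t : ℝ := 1 / (1 + schwartzNorm s (ofRealTest p₀)) with ht
  have ht0 : 0 < t := by positivity
  set p : 𝓢(EuclideanSpace ℝ (Fin 4), ℝ) := t • p₀ with hp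
  have hp_apply : ∀ y, p y = t * p₀ y := fun y => by rw [hp, smul_apply, smul_eq_mul]
  have hp0 : ∀ y, 0 ≤ p y := fun y => by rw [hp_apply]; exact mul_nonneg ht0.le (hp₀0 y)
  have hpnorm : schwartzNorm s (ofRealTest p) ≤ 1 := by
    rw [hp, schwartzNorm_ofRealTest_smul, abs_of_pos ht0, ht, div_mul_eq_mul_div, one_mul,
      div_le_one (by positivity)]
    linarith
  -- constants
  set q₀ : Plane := ⟨(0, 1), by decide⟩ with hq₀
  obtain ⟨Bw, hBw⟩ := (planeSpecies r q₀).bounded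
  obtain ⟨Bc, hBc⟩ := r.curvature.bounded
  have hBc0 : 0 ≤ Bc := (abs_nonneg _).trans (hBc fun _ => 1)
  obtain ⟨Cf, hCf0, hCf⟩ := exists_latticeSum_le (d := 4) f
  obtain ⟨Cg, hCg0, hCg⟩ := exists_latticeSum_le (d := 4) g
  obtain ⟨Ch, hCh0, hCh⟩ := exists_latticeSum_le (d := 4) h
  have hP : ∀ k, |∫ U, planeField r sch k q₀ p U ∂(wilsonAt r sch k)| ≤ C₀ * C₁ := fun k =>
    abs_integral_planeField_le r sch hU q₀ hpnorm k
  have hCC : 0 ≤ C₀ * C₁ := (abs_nonneg _).trans (hP 0)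
  have hkey : ∀ k, |sch.c r.curvature k| *
      (sch.a k ^ 4 * ∑ x ∈ box 4 (sch.L k), p (sch.a k • siteToE x)) *
        (|sch.m r.curvature k / 6| - Bw) ≤ C₀ * C₁ := fun k =>
    abs_c_mul_riemann_mul_sub_le r sch q₀ hBw hp0 k (hP k)
  -- eventual smallness of the mesh and largeness of the box
  have hev_a : ∀ᶠ k in atTop, sch.a k ≤ 1 / 2 :=
    sch.tendsto_a.eventually (eventually_le_nhds (by norm_num))
  have hev_aL : ∀ᶠ k in atTop, (1 : ℝ) ≤ sch.a k * sch.L k :=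
    sch.tendsto_L.eventually (eventually_ge_atTop 1)
  -- (1) the `κ₃` floor: `δ ≤ |c_k|³ D` eventually
  set D : ℝ := 6 * (Cf * Bc * (Cg * Bc) * (Ch * Bc)) with hD_def
  have hevD : ∀ᶠ k in atTop, δ ≤ |sch.c r.curvature k| ^ 3 * D := by
    filter_upwards [hSK, hev_a] with k hk ha
    have ha1 : sch.a k ≤ 1 := ha.trans (by norm_num)
    have hRf := hCf (sch.a k) (sch.a_pos k) ha1 (sch.L k)
    have hRg := hCg (sch.a k) (sch.a_pos k) ha1 (sch.L k)
    have hRh := hCh (sch.a k) (sch.a_pos k) ha1 (sch.L k)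
    have hmono : (sch.a k ^ 4 * ∑ x ∈ box 4 (sch.L k), |f (sch.a k • siteToE x)|) * Bc *
          ((sch.a k ^ 4 * ∑ x ∈ box 4 (sch.L k), |g (sch.a k • siteToE x)|) * Bc) *
          ((sch.a k ^ 4 * ∑ x ∈ box 4 (sch.L k), |h (sch.a k • siteToE x)|) * Bc) ≤
        Cf * Bc * (Cg * Bc) * (Ch * Bc) :=
      mul_le_mul (mul_le_mul (mul_le_mul_of_nonneg_right hRf hBc0)
        (mul_le_mul_of_nonneg_right hRg hBc0) (by positivity) (by positivity))
        (mul_le_mul_of_nonneg_right hRh hBc0) (by positivity) (by positivity)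
    calc δ ≤ _ := hk
      _ ≤ _ := abs_conn_three_le r sch hBc k f g h
      _ ≤ |sch.c r.curvature k| ^ 3 * D :=
          mul_le_mul_of_nonneg_left (mul_le_mul_of_nonneg_left hmono (by norm_num)) (by positivity)
  have hD : 0 < D := by
    obtain ⟨k, hk⟩ := hevD.exists
    by_contra hcon
    push Not at hcon
    have : |sch.c r.curvature k| ^ 3 * D ≤ 0 :=
      mul_nonpos_of_nonneg_of_nonpos (pow_nonneg (abs_nonneg _) 3) hcon
    linarith
  set c₀ : ℝ := min 1 (δ / D) with hc₀_def
  have hc₀ : 0 < c₀ := lt_min one_pos (div_pos hδ hD)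
  -- (4) the Riemann mass of the plateau: `R_k ≥ t / 16` eventually
  have hevR : ∀ᶠ k in atTop,
      t / 16 ≤ sch.a k ^ 4 * ∑ x ∈ box 4 (sch.L k), p (sch.a k • siteToE x) := by
    filter_upwards [hev_a, hev_aL] with k ha haL
    have hak := sch.a_pos k
    have hpl : (1 / (2 * sch.a k)) ^ 4 ≤ ∑ y ∈ box 4 (sch.L k), p₀ (sch.a k • siteToE y) :=
      pow_le_sum_box (g := ⇑p₀) (p := 0) (ρ := 1) hp₀0 hak (fun z hz => hp₀1 z hz) (by linarith)
        fun j => by simpa using haL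
    have h16 : sch.a k ^ 4 * (1 / (2 * sch.a k)) ^ 4 = 1 / 16 := by
      field_simp
      ring
    have hsum : sch.a k ^ 4 * ∑ x ∈ box 4 (sch.L k), p (sch.a k • siteToE x) =
        t * (sch.a k ^ 4 * ∑ x ∈ box 4 (sch.L k), p₀ (sch.a k • siteToE x)) := by
      rw [Finset.mul_sum, Finset.mul_sum, Finset.mul_sum]
      refine Finset.sum_congr rfl fun x _ => ?_
      rw [hp_apply]; ring
    rw [hsum]
    calc t / 16 = t * (sch.a k ^ 4 * (1 / (2 * sch.a k)) ^ 4) := by rw [h16]; ring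
      _ ≤ t * (sch.a k ^ 4 * ∑ y ∈ box 4 (sch.L k), p₀ (sch.a k • siteToE y)) :=
          mul_le_mul_of_nonneg_left (mul_le_mul_of_nonneg_left hpl (by positivity)) ht0.le
  -- (5) the eventual bound on the counterterm
  set x₀ : ℝ := c₀ * (t / 16) with hx₀
  have hx₀pos : 0 < x₀ := by positivity
  have hevM : ∀ᶠ k in atTop, |sch.m r.curvature k| ≤ 6 * (Bw + C₀ * C₁ / x₀) := by
    filter_upwards [hevD, hevR] with k hkD hkR
    have hc : c₀ ≤ |sch.c r.curvature k| := by
      have h3 : δ / D ≤ |sch.c r.curvature k| ^ 3 := by rw [div_le_iff₀ hD]; exact hkD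
      rcases le_or_gt 1 |sch.c r.curvature k| with h1 | h1
      · exact (min_le_left _ _).trans h1
      · exact (min_le_right _ _).trans
          (h3.trans (pow_le_of_le_one (abs_nonneg _) (le_of_lt h1) three_ne_zero))
    have hX : x₀ ≤ |sch.c r.curvature k| *
        (sch.a k ^ 4 * ∑ x ∈ box 4 (sch.L k), p (sch.a k • siteToE x)) :=
      mul_le_mul hc hkR (by positivity) (abs_nonneg _)
    have hk := hkey k
    have hMB : |sch.m r.curvature k / 6| - Bw ≤ C₀ * C₁ / x₀ := by
      by_cases hle : |sch.m r.curvature k / 6| - Bw ≤ 0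
      · exact hle.trans (div_nonneg hCC hx₀pos.le)
      · push Not at hle
        rw [le_div_iff₀ hx₀pos]
        calc (|sch.m r.curvature k / 6| - Bw) * x₀
            ≤ (|sch.m r.curvature k / 6| - Bw) * (|sch.c r.curvature k| *
                (sch.a k ^ 4 * ∑ x ∈ box 4 (sch.L k), p (sch.a k • siteToE x))) :=
              mul_le_mul_of_nonneg_left hX hle.le
          _ = |sch.c r.curvature k| *
                (sch.a k ^ 4 * ∑ x ∈ box 4 (sch.L k), p (sch.a k • siteToE x)) *
                  (|sch.m r.curvature k / 6| - Bw) := by ring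
          _ ≤ C₀ * C₁ := hk
    rw [abs_div, abs_of_pos (by norm_num : (0 : ℝ) < 6)] at hMB
    linarith
  exact exists_forall_abs_le_of_eventually hevM

end Summit.QuantumFields.YangMills.Theorems.WeakCouplingHypercubicLimit.TraceNormColdPressure

end
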